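import Literature.NumberTheory.GaloisRepresentations.SuperellipticPicDivisible
import HarnessLib

/-!
# `#Pic(C_{f,L})[3ⁿ] = 3^{2(d-1)n}` for `C_f : y³ = f(x)`, `deg f = d`, `3 ∤ d`, over ANY algebraically closed field

Topic `Literature/NumberTheory/GaloisRepresentations` (continues `SuperellipticPicDivisible`).  The torsion count
`#Pic[3ⁿ] = (#J[λ])^{2n}` of `PicardLambdaAdicRepDivisible` (there for `Pic(C_{f,K̄})` only, `K ∋ ζ₃`, and under the
divisibility hypothesis `hdiv`) is proved here for the divisor class group `Pic(C_{f,L}) = Cl(L(C_f)/L)` over an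
ARBITRARY algebraically closed field `L ⊇ K` containing a primitive cube root of unity `ζ₀` (i.e. `char L ≠ 3`),
unconditionally: `Pic⁰(C_{f,L})` is `3`-divisible by `SuperellipticPicDivisible` (Tsen), `J[λ] ≅ (𝔽₃^{roots f})⁰`
has `3^{d-1}` elements (`psiInf`, `SuperellipticLambdaTorsionCoprime`), and the dévissage along `λ = 1 - δ`
(`λ² = -3δ` on `Pic⁰`, `sum_deck_pow_smul_eq_zero_of_degree_eq_zero`) is redone in this generality.  In particular,
for the SPECIAL FIBRE `Pic(C_{f̄, κ̄})` of a Picard curve at a prime of good reduction (`κ̄` an algebraic closure of the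
residue field, `char ≠ 3`, `f̄` a separable quartic) `#Pic[3ⁿ] = 3^{6n}` as on the generic fibre
(`picard_card_torsionBy_three_pow`) — so that a deck-compatible reduction map injective on `J[λ]`
(`geomPic_eq_zero_of_three_pow_smul_eq_zero`) is automatically BIJECTIVE on `3ⁿ`-torsion, by counting.

## Main results (all proved; `δ = CyclicCoverDeck.ofRoot hζ₀.pow_eq_one`, `λ c = c - δ c`)

* `SuperellipticFunctionField.degree_deck_smul'` — the deck group preserves degrees.
* `sub_deck_smul_sub_deck_smul_of_degree_eq_zero` — `λ(λ c) = -3 δ c` on `Pic⁰`; `three_smul_eq_sub_deck_smul`,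
  `three_smul_eq_zero_iff_of_three` — `Pic[3] = Pic⁰ ∩ ker λ²`.
* `mem_lambdaTorsion_iff_of_three` — `J[λ] = Pic[3] ∩ ker λ`.
* `natCard_lambdaTorsion_of_three` — `#J[λ] = 3^{d-1}` (`d = deg f`).
* `natCard_torsionBy_three` — `#Pic[3] = (#J[λ])²`; `natCard_torsionBy_three_pow_succ`;
  **`natCard_torsionBy_three_pow`** — `#Pic(C_{f,L})[3ⁿ] = 3^{2(d-1)n}`; **`natCard_torsionBy_three_pow_of_natDegree_eq_four`**
  — `= 3^{6n}` for quartics (the special and generic fibres of a Picard curve alike).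

## References

* M. Rosen, *Number Theory in Function Fields*, GTM 210 (2002), Ch. 11, Thm. 11.12 and Corollary
  (`Cl⁰[ℓⁿ] ≅ (ℤ/ℓⁿ)^{2g}` over an algebraically closed constant field; here `ℓ = 3`, `g = d - 1`). [RosenFunctionFields2002]
* Yu. G. Zarhin, *Endomorphism algebras of abelian varieties with special reference to superelliptic Jacobians*
  (2018) = arXiv:1706.00110, §8 (`ℤ[δ] = ℤ[ζ_p] ↪ End J`, `J_λ`). [Zarhin2018SuperellipticJacobians]
* E. F. Schaefer, Math. Ann. 310 (1998), §3. [Schaefer1998]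
-/

noncomputable section

open Polynomial
open scoped Classical

namespace Literature.NumberTheory.GaloisRepresentations

open Literature.NumberTheory.DiophantineGeometry Literature.NumberTheory.DiophantineGeometry.AlgFunctionField

universe u v

attribute [local instance] Finsupp.comapSMul Finsupp.comapMulAction Finsupp.comapDistribMulAction

namespace SuperellipticFunctionField

variable {K : Type u} [Field K] {L : Type v} [Field L] [Algebra K L] {p : ℕ} {f : K[X]}
variable [Fact (Irreducible (superellipticPoly K L p f))]

/-- The deck group preserves degrees on `Pic(C_{f,L})` for `L` algebraically closed (all places are rational).
[folklore] -/
theorem degree_deck_smul' [IsAlgClosed L] (ξ : CyclicCoverDeck L p) (c : SuperellipticPic K L p f) :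
    SuperellipticPic.degree K L p f (ξ • c) = SuperellipticPic.degree K L p f c := by
  obtain ⟨D, rfl⟩ := SuperellipticPic.mk_surjective c
  rw [SuperellipticPic.deck_smul_mk, SuperellipticPic.degree_mk, SuperellipticPic.degree_mk]
  induction D using Finsupp.induction with
  | zero => rw [smul_zero]
  | single_add v n D _ _ ih =>
    have h1 : (ξ • v).degree = 1 := PlaceOver.isRational_of_isAlgClosed _
    have h2 : v.degree = 1 := PlaceOver.isRational_of_isAlgClosed _
    rw [smul_add, map_add, map_add, ih, Finsupp.comapSMul_single, Divisor.degree_single, Divisor.degree_single, h1, h2]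

end SuperellipticFunctionField

namespace SuperellipticFunctionField

variable {K : Type u} [Field K] {L : Type v} [Field L] [Algebra K L] {f : K[X]}
variable [Fact (Irreducible (superellipticPoly K L 3 f))] [IsAlgClosed L]

/-! ### `λ² = -3δ` on `Pic⁰` and `Pic[3] = Pic⁰ ∩ ker λ²` (`p = 3`, any algebraically closed `L`) -/

/-- **`λ(λ c) = -3 δ c` on `Pic⁰(C_{f,L})`** (`λ = 1 - δ`): the norm relation `c + δ c + δ² c = 0`
(`sum_deck_pow_smul_eq_zero_of_degree_eq_zero`; in `ℤ[ω]`, `(1 - ω)² = -3ω`). [cite: Zarhin2018SuperellipticJacobians, §8] -/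
theorem sub_deck_smul_sub_deck_smul_of_degree_eq_zero {ζ₀ : L} (hζ₀ : IsPrimitiveRoot ζ₀ 3) (hsep : f.Separable)
    (hndvd : ¬ 3 ∣ f.natDegree) {c : SuperellipticPic K L 3 f} (hc : SuperellipticPic.degree K L 3 f c = 0) :
    (c - CyclicCoverDeck.ofRoot hζ₀.pow_eq_one • c) -
        CyclicCoverDeck.ofRoot hζ₀.pow_eq_one • (c - CyclicCoverDeck.ofRoot hζ₀.pow_eq_one • c) =
      -(3 • (CyclicCoverDeck.ofRoot hζ₀.pow_eq_one • c)) := by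
  set δ := CyclicCoverDeck.ofRoot hζ₀.pow_eq_one with hδ
  have h := sum_deck_pow_smul_eq_zero_of_degree_eq_zero (K := K) hζ₀ hsep hndvd hc
  rw [Finset.sum_range_succ, Finset.sum_range_succ, Finset.sum_range_one, pow_zero, one_smul, pow_one, sq,
    mul_smul] at h
  rw [smul_sub, ← sub_eq_zero, ← h]
  abel

/-- **`3 c = λ(λ(-(δ² c)))` on `Pic⁰`** (`3 = -ω²λ²`, `δ³ = 1`). [cite: Zarhin2018SuperellipticJacobians, §8] -/
theorem three_smul_eq_sub_deck_smul {ζ₀ : L} (hζ₀ : IsPrimitiveRoot ζ₀ 3) (hsep : f.Separable)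
    (hndvd : ¬ 3 ∣ f.natDegree) {c : SuperellipticPic K L 3 f} (hc : SuperellipticPic.degree K L 3 f c = 0) :
    (3 • c : SuperellipticPic K L 3 f) =
      (-(CyclicCoverDeck.ofRoot hζ₀.pow_eq_one ^ 2 • c) - CyclicCoverDeck.ofRoot hζ₀.pow_eq_one •
          -(CyclicCoverDeck.ofRoot hζ₀.pow_eq_one ^ 2 • c)) -
        CyclicCoverDeck.ofRoot hζ₀.pow_eq_one •
          ((-(CyclicCoverDeck.ofRoot hζ₀.pow_eq_one ^ 2 • c)) - CyclicCoverDeck.ofRoot hζ₀.pow_eq_one •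
            -(CyclicCoverDeck.ofRoot hζ₀.pow_eq_one ^ 2 • c)) := by
  haveI : NeZero (3 : ℕ) := ⟨three_ne_zero⟩
  set δ := CyclicCoverDeck.ofRoot hζ₀.pow_eq_one with hδ
  have hc' : SuperellipticPic.degree K L 3 f (-(δ ^ 2 • c)) = 0 := by
    rw [map_neg, degree_deck_smul', hc, neg_zero]
  have hδ3 : δ * δ ^ 2 = 1 := by rw [← pow_succ']; exact CyclicCoverDeck.ofRoot_pow_eq_one hζ₀.pow_eq_one
  rw [sub_deck_smul_sub_deck_smul_of_degree_eq_zero hζ₀ hsep hndvd hc', smul_neg, smul_neg, neg_neg, smul_smul, hδ3,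
    one_smul]

/-- **`Pic[3] = Pic⁰ ∩ ker λ²`**: `3 c = 0 ↔ deg c = 0 ∧ λ(λ c) = 0`. [cite: Zarhin2018SuperellipticJacobians, §8] -/
theorem three_smul_eq_zero_iff_of_three {ζ₀ : L} (hζ₀ : IsPrimitiveRoot ζ₀ 3) (hsep : f.Separable)
    (hndvd : ¬ 3 ∣ f.natDegree) (c : SuperellipticPic K L 3 f) :
    (3 • c : SuperellipticPic K L 3 f) = 0 ↔
      SuperellipticPic.degree K L 3 f c = 0 ∧
        (c - CyclicCoverDeck.ofRoot hζ₀.pow_eq_one • c) -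
          CyclicCoverDeck.ofRoot hζ₀.pow_eq_one • (c - CyclicCoverDeck.ofRoot hζ₀.pow_eq_one • c) = 0 := by
  haveI : NeZero (3 : ℕ) := ⟨three_ne_zero⟩
  set δ := CyclicCoverDeck.ofRoot hζ₀.pow_eq_one with hδ
  constructor
  · intro h3
    have hdeg : SuperellipticPic.degree K L 3 f c = 0 :=
      jacobianTorsion_le_degreeZero K L 3 f three_ne_zero (AddSubgroup.torsionBy.nsmul_iff.2 h3)
    refine ⟨hdeg, ?_⟩
    rw [sub_deck_smul_sub_deck_smul_of_degree_eq_zero hζ₀ hsep hndvd hdeg, smul_comm, h3, smul_zero, neg_zero]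
  · rintro ⟨hdeg, hll⟩
    have hL : ∀ (j : ℕ) (x : SuperellipticPic K L 3 f), δ ^ j • x - δ • δ ^ j • x = δ ^ j • (x - δ • x) :=
      fun j x => by rw [smul_sub, smul_smul, smul_smul, ← pow_succ, ← pow_succ']
    have hneg : ∀ y : SuperellipticPic K L 3 f, (-y - δ • -y) - δ • (-y - δ • -y) = -((y - δ • y) - δ • (y - δ • y)) :=
      fun y => by simp only [smul_neg, smul_sub]; abel
    rw [three_smul_eq_sub_deck_smul hζ₀ hsep hndvd hdeg, ← hδ, hneg, hL 2 c, hL 2 (c - δ • c), hll, smul_zero, neg_zero]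

/-- **`J[λ] = Pic[3] ∩ ker λ`**: a class lies in `lambdaTorsion` iff it is `3`-torsion and fixed by `δ`
(torsion classes have degree `0`; a `δ`-fixed class is deck-fixed; `J[λ] ⊆ J[3]`). [cite: Zarhin2018SuperellipticJacobians, §8] -/
theorem mem_lambdaTorsion_iff_of_three {ζ₀ : L} (hζ₀ : IsPrimitiveRoot ζ₀ 3) (hsep : f.Separable)
    (hndvd : ¬ 3 ∣ f.natDegree) (c : SuperellipticPic K L 3 f) :
    c ∈ lambdaTorsion K L 3 f ↔
      c ∈ AddSubgroup.torsionBy (SuperellipticPic K L 3 f) (3 : ℕ) ∧ c - CyclicCoverDeck.ofRoot hζ₀.pow_eq_one • c = 0 := by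
  haveI : NeZero (3 : ℕ) := ⟨three_ne_zero⟩
  constructor
  · intro hc
    refine ⟨?_, ?_⟩
    · exact AddSubgroup.torsionBy.nsmul_iff.2 (nsmul_eq_zero_of_mem_lambdaTorsion hζ₀ hsep hndvd hc)
    · rw [sub_eq_zero]
      exact (((mem_lambdaTorsion K L 3 f).1 hc).2 _).symm
  · rintro ⟨h3, hfix⟩
    rw [sub_eq_zero] at hfix
    refine (mem_lambdaTorsion K L 3 f).2 ⟨jacobianTorsion_le_degreeZero K L 3 f three_ne_zero h3, ?_⟩
    exact forall_deck_smul_eq_of_ofRoot_smul_eq hζ₀ hfix.symm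

/-! ### `#J[λ] = 3^{d-1}` -/

/-- **`#J[λ] = 3^{deg f - 1}`** for `y³ = f(x)`, `3 ∤ deg f`, over any algebraically closed `L ∋ ζ₃`: `J[λ]` is the image
of the injective map `Ψ` from the heart `= (𝔽₃^{roots f})⁰` (`psiInf`, `psiInf_injective`, `exists_psiInf_eq`), of
`𝔽₃`-dimension `#roots - 1 = deg f - 1`. [cite: Schaefer1998, §3 Prop. 3.2] [cite: Zarhin2018SuperellipticJacobians, §8 (i)] -/
theorem natCard_lambdaTorsion_of_three {ζ₀ : L} (hζ₀ : IsPrimitiveRoot ζ₀ 3) (hsep : f.Separable) (hndvd : ¬ 3 ∣ f.natDegree) :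
    Nat.card (lambdaTorsion K L 3 f) = 3 ^ (f.natDegree - 1) := by
  have hcardR : Fintype.card (f.rootSet L) = f.natDegree := card_rootSet hsep
  have hnd : f.natDegree ≠ 0 := fun h0 => hndvd (h0 ▸ dvd_zero 3)
  haveI : Nonempty (f.rootSet L) := Fintype.card_pos_iff.1 (by rw [hcardR]; exact Nat.pos_of_ne_zero hnd)
  have hndvd' : ¬ 3 ∣ Fintype.card (f.rootSet L) := by rwa [hcardR]
  set Ψ := psiInf (K := K) (L := L) (p := 3) (f := f) hsep hndvd with hΨ
  have hinj : Function.Injective Ψ := psiInf_injective hζ₀ hsep hndvd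
  have hrange : Ψ.range = lambdaTorsion K L 3 f := by
    refine le_antisymm ?_ fun c hc => ?_
    · rintro _ ⟨v, rfl⟩
      exact psiInf_mem_lambdaTorsion hsep hndvd v
    · exact exists_psiInf_eq hζ₀ hsep hndvd hc
  rw [← hrange, ← Nat.card_congr (AddMonoidHom.ofInjective hinj).toEquiv,
    ← Nat.card_congr (augmentationEquivHeart 3 _ hndvd').toEquiv,
    Module.natCard_eq_pow_finrank (K := ZMod 3), Nat.card_zmod, finrank_augmentationSubmodule,
    Nat.card_eq_fintype_card, hcardR]

/-! ### `#Pic[3ⁿ] = (#J[λ])^{2n}` -/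

/-- **`#Pic[3] = (#J[λ])²`**: `λ : Pic[3] → J[λ]` is onto (`λ`-divisibility of `Pic⁰`, `exists_sub_deck_smul_eq_of_degree_eq_zero`)
with kernel `Pic[3] ∩ ker λ = J[λ]`. [cite: RosenFunctionFields2002, Ch. 11, Thm. 11.12] [cite: Zarhin2018SuperellipticJacobians, §8] -/
theorem natCard_torsionBy_three {ζ₀ : L} (hζ₀ : IsPrimitiveRoot ζ₀ 3) (hsep : f.Separable) (hndvd : ¬ 3 ∣ f.natDegree) :
    Nat.card (AddSubgroup.torsionBy (SuperellipticPic K L 3 f) (3 : ℕ)) = Nat.card (lambdaTorsion K L 3 f) ^ 2 := by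
  haveI : NeZero (3 : ℕ) := ⟨three_ne_zero⟩
  set δ := CyclicCoverDeck.ofRoot hζ₀.pow_eq_one with hδ
  set A₃ : AddSubgroup (SuperellipticPic K L 3 f) := AddSubgroup.torsionBy (SuperellipticPic K L 3 f) (3 : ℕ) with hA₃
  set lam : SuperellipticPic K L 3 f →+ SuperellipticPic K L 3 f :=
    AddMonoidHom.id _ - DistribSMul.toAddMonoidHom (SuperellipticPic K L 3 f) δ with hlam
  have hlam_apply : ∀ x, lam x = x - δ • x := fun x => rfl
  set ψ : A₃ →+ SuperellipticPic K L 3 f := lam.comp A₃.subtype with hψ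
  have hψ_apply : ∀ x : A₃, ψ x = (x : SuperellipticPic K L 3 f) - δ • (x : SuperellipticPic K L 3 f) := fun x => rfl
  -- `λ (Pic[3]) ⊆ J[λ]`
  have hmem : ∀ c : SuperellipticPic K L 3 f, c ∈ A₃ → c - δ • c ∈ lambdaTorsion K L 3 f := by
    intro c hc
    have h3 : (3 • c : SuperellipticPic K L 3 f) = 0 := AddSubgroup.torsionBy.nsmul_iff.1 hc
    rw [mem_lambdaTorsion_iff_of_three hζ₀ hsep hndvd]
    refine ⟨AddSubgroup.torsionBy.nsmul_iff.2 ?_, ((three_smul_eq_zero_iff_of_three hζ₀ hsep hndvd c).1 h3).2⟩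
    rw [smul_sub, smul_comm, h3, smul_zero, sub_zero]
  -- range `= J[λ]`
  have hrange : ψ.range = lambdaTorsion K L 3 f := by
    apply le_antisymm
    · rintro _ ⟨⟨c, hc⟩, rfl⟩
      exact hmem c hc
    · intro x hx
      have hx' := (mem_lambdaTorsion_iff_of_three hζ₀ hsep hndvd x).1 hx
      have hdeg : SuperellipticPic.degree K L 3 f x = 0 :=
        jacobianTorsion_le_degreeZero K L 3 f three_ne_zero hx'.1
      obtain ⟨y, hydeg, rfl⟩ := exists_sub_deck_smul_eq_of_degree_eq_zero hζ₀ hsep hndvd hdeg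
      have hy3 : (3 • y : SuperellipticPic K L 3 f) = 0 :=
        (three_smul_eq_zero_iff_of_three hζ₀ hsep hndvd y).2 ⟨hydeg, hx'.2⟩
      exact ⟨⟨y, AddSubgroup.torsionBy.nsmul_iff.2 hy3⟩, rfl⟩
  -- kernel `≅ J[λ]`
  have hle : lambdaTorsion K L 3 f ≤ A₃ := fun x hx => ((mem_lambdaTorsion_iff_of_three hζ₀ hsep hndvd x).1 hx).1
  have hker : ψ.ker = (lambdaTorsion K L 3 f).addSubgroupOf A₃ := by
    ext ⟨x, hx⟩
    rw [AddMonoidHom.mem_ker, AddSubgroup.mem_addSubgroupOf, hψ_apply, mem_lambdaTorsion_iff_of_three hζ₀ hsep hndvd]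
    exact ⟨fun h => ⟨hx, h⟩, fun h => h.2⟩
  have h := AddSubgroup.card_mul_index ψ.ker
  rw [AddSubgroup.index_ker, hrange, hker, Nat.card_congr (AddSubgroup.addSubgroupOfEquivOfLe hle).toEquiv] at h
  rw [← h, sq]

/-- **`Pic⁰(C_{f,L})` is `3`-divisible** (any algebraically closed `L ∋ ζ₃`; `exists_sub_deck_smul_eq_of_degree_eq_zero`
twice and `3 = -ω²λ²`). [cite: RosenFunctionFields2002, Ch. 11, Thm. 11.12] -/
theorem exists_three_smul_eq_of_degree_eq_zero {ζ₀ : L} (hζ₀ : IsPrimitiveRoot ζ₀ 3) (hsep : f.Separable)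
    (hndvd : ¬ 3 ∣ f.natDegree) {c : SuperellipticPic K L 3 f} (hc : SuperellipticPic.degree K L 3 f c = 0) :
    ∃ c' : SuperellipticPic K L 3 f, SuperellipticPic.degree K L 3 f c' = 0 ∧ 3 • c' = c := by
  haveI : NeZero (3 : ℕ) := ⟨three_ne_zero⟩
  set δ := CyclicCoverDeck.ofRoot hζ₀.pow_eq_one with hδ
  obtain ⟨c₁, hc₁, rfl⟩ := exists_sub_deck_smul_eq_of_degree_eq_zero hζ₀ hsep hndvd hc
  obtain ⟨c₂, hc₂, rfl⟩ := exists_sub_deck_smul_eq_of_degree_eq_zero hζ₀ hsep hndvd hc₁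
  refine ⟨-(δ • c₂), by rw [map_neg, degree_deck_smul', hc₂, neg_zero], ?_⟩
  rw [sub_deck_smul_sub_deck_smul_of_degree_eq_zero hζ₀ hsep hndvd hc₂, smul_neg]

/-- **`#Pic[3ⁿ⁺¹] = #Pic[3ⁿ] · #Pic[3]`**: `3 • : Pic[3ⁿ⁺¹] → Pic[3ⁿ]` is onto (`3`-divisibility) with kernel `Pic[3]`.
[cite: RosenFunctionFields2002, Ch. 11, Thm. 11.12] -/
theorem natCard_torsionBy_three_pow_succ {ζ₀ : L} (hζ₀ : IsPrimitiveRoot ζ₀ 3) (hsep : f.Separable)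
    (hndvd : ¬ 3 ∣ f.natDegree) (n : ℕ) :
    Nat.card (AddSubgroup.torsionBy (SuperellipticPic K L 3 f) (3 ^ (n + 1) : ℕ)) =
      Nat.card (AddSubgroup.torsionBy (SuperellipticPic K L 3 f) (3 ^ n : ℕ)) *
        Nat.card (AddSubgroup.torsionBy (SuperellipticPic K L 3 f) (3 : ℕ)) := by
  set A : AddSubgroup (SuperellipticPic K L 3 f) := AddSubgroup.torsionBy (SuperellipticPic K L 3 f) (3 ^ (n + 1) : ℕ) with hA
  set ψ : A →+ SuperellipticPic K L 3 f :=
    (nsmulAddMonoidHom 3 : SuperellipticPic K L 3 f →+ SuperellipticPic K L 3 f).comp A.subtype with hψ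
  have hψapply : ∀ x : A, ψ x = 3 • (x : SuperellipticPic K L 3 f) := fun x => rfl
  -- range `= Pic[3ⁿ]`
  have hrange : ψ.range = AddSubgroup.torsionBy (SuperellipticPic K L 3 f) (3 ^ n : ℕ) := by
    apply le_antisymm
    · rintro _ ⟨⟨c, hc⟩, rfl⟩
      refine AddSubgroup.torsionBy.nsmul_iff.2 ?_
      rw [hψapply, ← mul_smul, ← pow_succ]
      exact AddSubgroup.torsionBy.nsmul_iff.1 hc
    · intro x hx
      have hx' : (3 ^ n • x : SuperellipticPic K L 3 f) = 0 := AddSubgroup.torsionBy.nsmul_iff.1 hx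
      have hdeg : SuperellipticPic.degree K L 3 f x = 0 :=
        jacobianTorsion_le_degreeZero K L 3 f (pow_ne_zero n three_ne_zero) hx
      obtain ⟨y, -, rfl⟩ := exists_three_smul_eq_of_degree_eq_zero hζ₀ hsep hndvd hdeg
      refine ⟨⟨y, AddSubgroup.torsionBy.nsmul_iff.2 ?_⟩, rfl⟩
      rw [pow_succ, mul_smul, hx']
  -- kernel `≅ Pic[3]`
  have hle : AddSubgroup.torsionBy (SuperellipticPic K L 3 f) (3 : ℕ) ≤ A := fun x hx => by
    refine AddSubgroup.torsionBy.nsmul_iff.2 ?_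
    rw [pow_succ, mul_smul, AddSubgroup.torsionBy.nsmul_iff.1 hx, smul_zero]
  have hker : ψ.ker = (AddSubgroup.torsionBy (SuperellipticPic K L 3 f) (3 : ℕ)).addSubgroupOf A := by
    ext ⟨x, hx⟩
    rw [AddMonoidHom.mem_ker, AddSubgroup.mem_addSubgroupOf, hψapply]
    exact AddSubgroup.torsionBy.nsmul_iff.symm
  have h := AddSubgroup.card_mul_index ψ.ker
  rw [AddSubgroup.index_ker, hrange, hker, Nat.card_congr (AddSubgroup.addSubgroupOfEquivOfLe hle).toEquiv] at h
  rw [← h, mul_comm]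

/-- **`#Pic(C_{f,L})[3ⁿ] = 3^{2(d-1)n}`**, `d = deg f`, `3 ∤ d`, over ANY algebraically closed `L ∋ ζ₃` — the `ℓ = 3` case of
`Cl⁰[ℓⁿ] ≅ (ℤ/ℓⁿ)^{2g}` (`g = d - 1`) for the function fields `L(C_f)`, `C_f : y³ = f(x)`, proved without the Jacobian
(Tsen for the divisibility, Schaefer–Zarhin for `#J[λ] = 3^{d-1}`, dévissage along `λ`).
[cite: RosenFunctionFields2002, Ch. 11, Thm. 11.12] [cite: Zarhin2018SuperellipticJacobians, §8] -/
theorem natCard_torsionBy_three_pow {ζ₀ : L} (hζ₀ : IsPrimitiveRoot ζ₀ 3) (hsep : f.Separable) (hndvd : ¬ 3 ∣ f.natDegree)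
    (n : ℕ) :
    Nat.card (AddSubgroup.torsionBy (SuperellipticPic K L 3 f) (3 ^ n : ℕ)) = 3 ^ (2 * (f.natDegree - 1) * n) := by
  induction n with
  | zero =>
    simp only [mul_zero, pow_zero]
    haveI : Subsingleton (AddSubgroup.torsionBy (SuperellipticPic K L 3 f) (1 : ℕ)) := by
      refine ⟨fun x y => Subtype.ext ?_⟩
      have hx : ((1 : ℕ) • (x : SuperellipticPic K L 3 f)) = 0 := AddSubgroup.torsionBy.nsmul_iff.1 x.2
      have hy : ((1 : ℕ) • (y : SuperellipticPic K L 3 f)) = 0 := AddSubgroup.torsionBy.nsmul_iff.1 y.2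
      rw [one_nsmul] at hx hy
      rw [hx, hy]
    exact Nat.card_unique
  | succ n ih =>
    rw [natCard_torsionBy_three_pow_succ hζ₀ hsep hndvd n, ih, natCard_torsionBy_three hζ₀ hsep hndvd,
      natCard_lambdaTorsion_of_three hζ₀ hsep hndvd, ← pow_mul, ← pow_add]
    congr 1
    ring

/-- **`#Pic(C_{f,L})[3ⁿ] = 3^{6n}` for a separable QUARTIC `f`** over any algebraically closed `L ∋ ζ₃` — in particular for
the special fibre `Pic(C_{f̄,κ̄})` of a Picard curve at a prime of good reduction, as for the generic fibre
(`picard_card_torsionBy_three_pow`). [cite: RosenFunctionFields2002, Ch. 11, Thm. 11.12] [cite: Upton2009, §2] -/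
theorem natCard_torsionBy_three_pow_of_natDegree_eq_four {ζ₀ : L} (hζ₀ : IsPrimitiveRoot ζ₀ 3) (hsep : f.Separable)
    (h4 : f.natDegree = 4) (n : ℕ) :
    Nat.card (AddSubgroup.torsionBy (SuperellipticPic K L 3 f) (3 ^ n : ℕ)) = 3 ^ (6 * n) := by
  rw [natCard_torsionBy_three_pow hζ₀ hsep (by rw [h4]; decide) n, h4]

end SuperellipticFunctionField

end Literature.NumberTheory.GaloisRepresentations
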